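import Literature.NumberTheory.Sieve.BombieriAsymptoticSieveRoughCells
import Mathlib.MeasureTheory.Integral.IntervalIntegral.IntegrationByParts
import HarnessLib

/-!
# Bombieri's `P_r` law, min form: consistency of the weight at `r = 2` with the `P₂` fact

Topic `Literature/NumberTheory/Sieve`, family `parity`. Proof file (no named fact, no definition):
`BombieriRoughCells.bombieriMinWeight_two` — for a continuous test function `g` vanishing on `(−∞, η]`
(`η > 0`), the one-dimensional weight of `BombieriAsymptoticSievePrDistributionMin.lean` at `r = 2`,
`bombieriMinWeight 2 g = ∫_{w>1} g(1/w)·I₁(w−1)/(w−1) dw`, EQUALS Bombieri's `T₂`-integral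
`∫₀^{1/2} g(u) du/(u(1−u))` of the tree's (proved) `Bombieri1976_P2Distribution`
(`BombieriAsymptoticSievePrDistribution.lean`): the kernel is `1_{w ≥ 2}/(w−1)` and `u = 1/w`.
This certifies, at `r = 2`, the conditioning-on-`u₁` reduction of `∫_{T_r} g(u₁) dμ_r` used to vendor
`Bombieri1976_PrDistributionMin`.
-/

noncomputable section

open Filter Finset MeasureTheory Set intervalIntegral
open scoped Topology

namespace Literature.NumberTheory.Sieve

namespace BombieriRoughCells

/-- The kernel at `r = 2` is `1/(w − 1)` on `[2, ∞)`. [folklore] -/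
theorem kernel_two_eq {w : ℝ} (hw : 2 ≤ w) : kernel 2 w = 1 / (w - 1) := by
  unfold kernel
  rw [show (2 - 1 : ℕ) = 1 from rfl, roughCellDensity_one_of_one_le (by linarith)]

/-- The `T₂`-density `G(u) = g(u)/(u(1−u))` of a continuous `g` vanishing on `(−∞, η]` (`η > 0`) is
continuous on `(−∞, 1)`. [folklore] -/
theorem continuousOn_T2density {g : ℝ → ℝ} (hg : Continuous g) {η : ℝ} (hη : 0 < η)
    (hgη : ∀ u, u ≤ η → g u = 0) : ContinuousOn (fun u : ℝ => g u / (u * (1 - u))) (Iio 1) := by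
  intro u hu
  refine ContinuousAt.continuousWithinAt ?_
  rcases lt_or_ge u η with h | h
  · -- `G = 0` near `u`
    have hev : (fun u : ℝ => g u / (u * (1 - u))) =ᶠ[𝓝 u] fun _ => 0 := by
      filter_upwards [Iio_mem_nhds h] with v hv
      rw [hgη v (le_of_lt hv), zero_div]
    exact hev.continuousAt
  · have hu0 : u ≠ 0 := by intro h0; rw [h0] at h; linarith
    have hu1 : 1 - u ≠ 0 := by rw [Set.mem_Iio] at hu; linarith
    exact hg.continuousAt.div (continuousAt_id.mul (continuousAt_const.sub continuousAt_id))
      (mul_ne_zero hu0 hu1)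

/-- **The weight at `r = 2` is Bombieri's `T₂`-integral**: for `g` continuous vanishing on `(−∞, η]`
(`η > 0`), `bombieriMinWeight 2 g = ∫₀^{1/2} g(u)/(u(1−u)) du` (substitution `u = 1/w`). [folklore] -/
theorem bombieriMinWeight_two {g : ℝ → ℝ} (hg : Continuous g) {η : ℝ} (hη : 0 < η)
    (hgη : ∀ u, u ≤ η → g u = 0) :
    bombieriMinWeight 2 g = ∫ u in (0 : ℝ)..(1 / 2), g u / (u * (1 - u)) := by
  have hr : (2 : ℕ) ≤ 2 := le_rfl
  set M : ℝ := max 2 (1 / η) with hM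
  have hM2 : 2 ≤ M := le_max_left _ _
  have hM1 : 1 ≤ M := by linarith
  have hM0 : 0 < M := by linarith
  have hMη : 1 / η ≤ M := le_max_right _ _
  have hMη' : M⁻¹ ≤ η := by
    rw [inv_le_comm₀ hM0 hη, ← one_div]; exact hMη
  set G : ℝ → ℝ := fun u => g u / (u * (1 - u)) with hG
  -- (1) reduce to `[2, M]`, where the kernel is `1/(w-1)`
  rw [weight_eq_intervalIntegral hη hgη hM1 hMη,
    ← integral_add_adjacent_intervals
      (intervalIntegrable_integrand hr hg hgη (le_refl (1 : ℝ)) (by norm_num : (1 : ℝ) ≤ 2))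
      (intervalIntegrable_integrand hr hg hgη (by norm_num : (1 : ℝ) ≤ 2) hM1)]
  have h0 : ∫ w in (1 : ℝ)..2, g (1 / w) * kernel 2 w = 0 := by
    refine intervalIntegral_eq_zero_of_forall_mem_Ioo fun t ht => ?_
    rw [kernel_eq_zero_of_lt_two hr (lt_of_lt_of_le ht.2 (max_le (by norm_num) le_rfl)), mul_zero]
  rw [h0, zero_add]
  -- (2) the substitution `u = w⁻¹` on `[2, M]`
  set f : ℝ → ℝ := fun w => w⁻¹ with hf
  set f' : ℝ → ℝ := fun w => -(w ^ 2)⁻¹ with hf'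
  have hpt : ∀ w ∈ uIcc (2 : ℝ) M, g (1 / w) * kernel 2 w = -((G ∘ f) w * f' w) := by
    intro w hw
    rw [Set.uIcc_of_le hM2] at hw
    have hw2 : 2 ≤ w := hw.1
    have hw0 : w ≠ 0 := by linarith
    have hw1 : w - 1 ≠ 0 := by linarith
    rw [kernel_two_eq hw2]
    simp only [Function.comp, hG, hf, hf', one_div]
    field_simp
  rw [integral_congr hpt, intervalIntegral.integral_neg]
  have hsub : ∫ w in (2 : ℝ)..M, (G ∘ f) w * f' w = ∫ u in f 2..f M, G u := by
    refine integral_comp_mul_deriv'' ?_ ?_ ?_ ?_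
    · exact (continuousOn_inv₀.mono fun w hw => by
        rw [Set.uIcc_of_le hM2] at hw; exact ne_of_gt (by linarith [hw.1]))
    · intro w hw
      rw [min_eq_left hM2, max_eq_right hM2] at hw
      have hw0 : w ≠ 0 := by linarith [hw.1]
      exact (hasDerivAt_inv hw0).hasDerivWithinAt
    · refine ContinuousOn.neg (ContinuousOn.inv₀ (continuousOn_pow 2) fun w hw => ?_)
      rw [Set.uIcc_of_le hM2] at hw
      exact pow_ne_zero 2 (by linarith [hw.1])
    · refine (continuousOn_T2density hg hη hgη).mono ?_
      rintro u ⟨w, hw, rfl⟩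
      rw [Set.uIcc_of_le hM2] at hw
      rw [Set.mem_Iio, hf]
      have hw2 : (2 : ℝ) ≤ w := hw.1
      calc w⁻¹ ≤ 2⁻¹ := by rw [inv_le_inv₀ (by linarith) (by norm_num)]; exact hw2
        _ < 1 := by norm_num
  rw [hsub]
  simp only [hf]
  -- (3) `−∫_{1/2}^{1/M} G = ∫_{1/M}^{1/2} G = ∫_0^{1/2} G`
  rw [intervalIntegral.integral_symm, neg_neg]
  have hM2' : M⁻¹ ≤ (2 : ℝ)⁻¹ := by rw [inv_le_inv₀ hM0 (by norm_num)]; exact hM2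
  have hcont' : ContinuousOn G (Set.uIcc 0 M⁻¹) :=
    (continuousOn_T2density hg hη hgη).mono fun u hu => by
      rw [Set.uIcc_of_le (inv_nonneg.mpr hM0.le)] at hu
      rw [Set.mem_Iio]
      linarith [hu.2]
  have hcont'' : ContinuousOn G (Set.uIcc M⁻¹ (2 : ℝ)⁻¹) :=
    (continuousOn_T2density hg hη hgη).mono fun u hu => by
      rw [Set.uIcc_of_le hM2'] at hu
      rw [Set.mem_Iio]
      linarith [hu.2]
  have hsplit : ∫ u in (0 : ℝ)..2⁻¹, G u = (∫ u in (0 : ℝ)..M⁻¹, G u) + ∫ u in M⁻¹..2⁻¹, G u :=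
    (integral_add_adjacent_intervals hcont'.intervalIntegrable hcont''.intervalIntegrable).symm
  have hz : ∫ u in (0 : ℝ)..M⁻¹, G u = 0 := by
    refine intervalIntegral_eq_zero_of_forall_mem_Ioo fun t ht => ?_
    have ht' : t < M⁻¹ := lt_of_lt_of_le ht.2 (max_le (inv_nonneg.mpr hM0.le) le_rfl)
    simp only [hG]
    rw [hgη t (ht'.le.trans hMη'), zero_div]
  rw [show (1 : ℝ) / 2 = 2⁻¹ by norm_num, hsplit, hz, zero_add]

end BombieriRoughCells

end Literature.NumberTheory.Sieve

end
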